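import Mathlib
import HarnessLib
import Summits.MatrixMultiplication.MatrixMultiplication.Theorems.OutsiderSandwichSquaredLaserPacking

/-!
# OutsiderSandwich — the block-one transfer: `C₁ ≳ ⟨2,2,2⟩ ⟹ BlockOneIsMM ⟹ LaserTangency`
(decomp-mm lens-4, g18)

Route `route-MatrixMultiplication-OutsiderSandwich`; line «block-one transfer» for the crux
`LaserTangency` (its spectral stub).  `C₁ = coupling₁` is the explicit `4×4×4` coupled block of
`cw₂ ⊗ cw₂` (two copies of `⟨2,2,1⟩` glued along the `x`-leg).

* `blockOneIsMM_of_asymptoticRestriction` — if for every `ε > 0` and infinitely many `N` the power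
  `C₁^{⊠N}`, helped by a unit tensor `⟨B⟩` with `B ≤ 2^{εN}`, RESTRICTS to `⟨2,2,2⟩^{⊠N}`, then
  `F⟨2,2,2⟩ ≤ F(C₁)` for every universal spectral point `F` (item `BlockOneIsMM`, 27147): apply `F`
  (monotone, multiplicative, `F⟨B⟩ = B`), take `N`-th roots, let `ε → 0⁺`.
* `laserTangency_of_asymptoticRestriction` — hence the crux `LaserTangency` (tree:
  `laserTangency_of_blockOneIsMM`); `blockOneIsMM_of_asymptoticRestriction` has the exact type of the
  line's `stub_spectralTransfer`.

(The converse of the first implication is Strassen's spectral characterisation of the asymptotic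
preorder; it is not needed by the line.)  References: [Strassen1988, Thm. 3.8];
[BurgisserClausenShokrollahi1997, §15.6]; [ChristandlVranaZuiddam2023, §1.1].
-/

noncomputable section

open Filter Topology
open Literature.Computability.AlgebraicComplexity
open Summit.MatrixMultiplication.MatrixMultiplication.Theorems.OutsiderSandwichCoupling (coupling₁)

namespace Summit.MatrixMultiplication.MatrixMultiplication.Theorems.OutsiderSandwichBlockOneTransfer

/-- **`C₁ ≳ ⟨2,2,2⟩` (sub-exponentially helped restriction on powers) `⟹ BlockOneIsMM`.** -/
theorem blockOneIsMM_of_asymptoticRestriction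
    (h : ∀ ε : ℝ, 0 < ε → ∀ N₀ : ℕ, ∃ N : ℕ, N₀ ≤ N ∧ ∃ B : ℕ,
      TensorRestrictsTo (kroneckerTensor (unitTensor ℂ B) (kroneckerPow coupling₁ N))
        (kroneckerPow (matMulTensor ℂ 2 2 2) N) ∧ (B : ℝ) ≤ (2 : ℝ) ^ (ε * N)) :
    Theses.OutsiderSandwich.BlockOneIsMM := by
  refine OutsiderSandwichBlockOneItems.blockOneIsMM_iff.2 fun F hF => ?_
  have hg0 : 0 ≤ F (matMulTensor ℂ 2 2 2) := hF.nonneg _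
  have hc0 : 0 ≤ F coupling₁ := hF.nonneg _
  -- for every `ε > 0`: `g ≤ 2^ε c`
  have key : ∀ ε : ℝ, 0 < ε → F (matMulTensor ℂ 2 2 2) ≤ (2 : ℝ) ^ ε * F coupling₁ := by
    intro ε hε
    obtain ⟨N, hN, B, hres, hB⟩ := h ε hε 1
    have hN0 : N ≠ 0 := by omega
    have hm := hF.mono _ _ hres
    simp only [hF.map_kronecker, hF.map_unitTensor, hF.map_kroneckerPow] at hm
    -- `hm : g^N ≤ B * c^N`
    have e2 : (2 : ℝ) ^ (ε * N) = ((2 : ℝ) ^ ε) ^ N := Real.rpow_mul_natCast (by norm_num) _ _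
    rw [e2] at hB
    have hcN : 0 ≤ F coupling₁ ^ N := pow_nonneg hc0 N
    have hpow : F (matMulTensor ℂ 2 2 2) ^ N ≤ ((2 : ℝ) ^ ε * F coupling₁) ^ N :=
      calc F (matMulTensor ℂ 2 2 2) ^ N ≤ (B : ℝ) * F coupling₁ ^ N := hm
        _ ≤ ((2 : ℝ) ^ ε) ^ N * F coupling₁ ^ N := mul_le_mul_of_nonneg_right hB hcN
        _ = ((2 : ℝ) ^ ε * F coupling₁) ^ N := by rw [mul_pow]
    exact le_of_pow_le_pow_left₀ hN0 (by positivity) hpow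
  -- `ε → 0⁺`
  have hlim : Tendsto (fun ε : ℝ => (2 : ℝ) ^ ε * F coupling₁) (𝓝[>] 0)
      (𝓝 ((2 : ℝ) ^ (0 : ℝ) * F coupling₁)) := by
    have hc : ContinuousAt (fun x : ℝ => (2 : ℝ) ^ x) 0 := Real.continuousAt_const_rpow (by norm_num)
    exact (hc.tendsto.mono_left nhdsWithin_le_nhds).mul_const _
  rw [Real.rpow_zero, one_mul] at hlim
  refine ge_of_tendsto hlim ?_
  filter_upwards [self_mem_nhdsWithin] with ε hε using key ε hε

/-- **Hence the crux: `C₁ ≳ ⟨2,2,2⟩ ⟹ LaserTangency`.** -/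
theorem laserTangency_of_asymptoticRestriction
    (h : ∀ ε : ℝ, 0 < ε → ∀ N₀ : ℕ, ∃ N : ℕ, N₀ ≤ N ∧ ∃ B : ℕ,
      TensorRestrictsTo (kroneckerTensor (unitTensor ℂ B) (kroneckerPow coupling₁ N))
        (kroneckerPow (matMulTensor ℂ 2 2 2) N) ∧ (B : ℝ) ≤ (2 : ℝ) ^ (ε * N)) :
    Theses.OutsiderSandwich.LaserTangency :=
  OutsiderSandwichSquaredLaserPacking.laserTangency_of_blockOneIsMM
    (blockOneIsMM_of_asymptoticRestriction h)

end Summit.MatrixMultiplication.MatrixMultiplication.Theorems.OutsiderSandwichBlockOneTransfer
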